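import Mathlib.RingTheory.Trace.Basic
import Mathlib.LinearAlgebra.Trace
import Mathlib.LinearAlgebra.FiniteDimensional.Defs
import Mathlib.Algebra.Algebra.Pi
import HarnessLib

/-!
# The trace form of a positive anti-involution restricted to a stable field in a corner

D. Mumford, *Abelian Varieties* (1970), §21 (proof of Thm. 2, p. 201) and G. Shimura, *Abelian Varieties with
Complex Multiplication and Modular Functions* (1998), §5.1 Proposition 5 (p. 38, with Proposition 2 p. 36
«`tr(ξ) = m·Tr_{K/ℚ}(ξ)`»): the positive involution `ξ ↦ ξ'` of `End⁰(B)` («`tr(ξξ') > 0` for every `ξ ≠ 0`»)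
maps the centre `K` onto itself, and «Hence we have `Tr_{K/Q}(ξξ') > 0` for every `ξ ≠ 0` in `K`» — because the
trace of (left) multiplication by `ξ ∈ K` on the ambient algebra is a POSITIVE MULTIPLE `m·Tr_{K/ℚ}(ξ)` of the field
trace.  The same transfer serves a field `R₀` sitting in a CORNER `e·D·e` of `D` (unit `e = φ(1)` an idempotent
`≠ 1`), e.g. the field `Z·e` generated by a simple factor `Z` of the centre of a stable semisimple subalgebra (the
Hecke algebra of a Shimura curve inside `End⁰` of its Jacobian, [Liu2021] App. D (D.6)).

PURE ALGEBRA, for a finite-dimensional `ℚ`-algebra `D`, a field `R₀` finite over `ℚ`, and an injective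
multiplicative `ℚ`-linear map `φ : R₀ → D` (NOT assumed unital: `φ 1 = e` is an idempotent):

* §1 `exists_trace_lmul_eq_nsmul_trace` — there is `n > 0` (the `R₀`-dimension of the corner `e·D`) with
  `Tr_ℚ(L_{φ y} on D) = n • Tr_{R₀/ℚ}(y)` for all `y : R₀` (`D = eD ⊕ (1-e)D`, `L_{φ y}` is `y`-scalar
  multiplication on the `R₀`-vector space `eD` and `0` on `(1-e)D`; tower law `Algebra.trace_trace`).
* §2 `exists_ringHom_trace_mul_pos_of_antiHom` — if `τ : D → Dᵐᵒᵖ` is a ring anti-endomorphism with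
  POSITIVE trace form `0 < Tr_ℚ(L_{x·τx})` (`x ≠ 0`) which STABILISES `φ(R₀)` (`τ(φ r) ∈ φ(R₀)`), then
  `ρ := φ⁻¹ ∘ τ ∘ φ` is a ring endomorphism of `R₀` with `0 < Tr_{R₀/ℚ}(r·ρ r)` for `r ≠ 0` (and `0 ≤` always) —
  the input of Shimura's Lemma 2 (tree: `NumberFields.PositiveInvolution`,
  `ComplexMultiplication.EndFieldCMOfPositiveInvolutionOverSubfield`).

Theorems only; no definition, no named fact, no instance, no `sorry`.

## References
* [MumfordAV1970] D. Mumford, *Abelian Varieties* (1970), §21, proof of Thm. 2 (p. 201): the Rosati involution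
  restricted to the centre.
* [Shimura1998] G. Shimura, *Abelian Varieties with Complex Multiplication and Modular Functions* (1998), §5.1
  Proposition 2 (p. 36) and Proposition 5 (p. 38).
* [Liu2021] Y. Liu, *Fourier–Jacobi cycles and arithmetic relative trace formula*, Camb. J. Math. 9 (2021), App. D.
-/

noncomputable section

namespace Literature.RingTheory.Idempotents

open Module

variable {D : Type*} [Ring D] [Algebra ℚ D] [Module.Finite ℚ D]
variable {R₀ : Type*} [Field R₀] [Algebra ℚ R₀] [Module.Finite ℚ R₀]

/-! ## §1 The trace of left multiplication by a corner scalar -/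

/-- **`Tr_ℚ(L_{φ y} ∣ D) = n • Tr_{R₀/ℚ}(y)` with `n > 0`** for an injective multiplicative `ℚ`-linear map
`φ : R₀ → D` from a field (`e = φ 1` an idempotent, `n = dim_{R₀}(e·D)`): Shimura's «`tr(ξ) = m·Tr_{K/Q}(ξ)`»
for a corner field. [cite: Shimura1998, §5.1 Proposition 2 (p. 36)] [cite: MumfordAV1970, §21 proof of Thm. 2 (p. 201)] -/
theorem exists_trace_lmul_eq_nsmul_trace (φ : R₀ →ₗ[ℚ] D) (hmul : ∀ a b : R₀, φ (a * b) = φ a * φ b)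
    (hφ : Function.Injective φ) :
    ∃ n : ℕ, 0 < n ∧ ∀ y : R₀,
      LinearMap.trace ℚ D (Algebra.lmul ℚ D (φ y)) = n • Algebra.trace ℚ R₀ y := by
  classical
  -- the unit `e = φ 1` of the corner
  have heφ : ∀ r : R₀, φ 1 * φ r = φ r := fun r => by rw [← hmul, one_mul]
  have hφe : ∀ r : R₀, φ r * φ 1 = φ r := fun r => by rw [← hmul, mul_one]
  -- the corner `V = e·D`
  let V : Submodule ℚ D := LinearMap.range (Algebra.lmul ℚ D (φ 1) : D →ₗ[ℚ] D)
  have hmemV : ∀ {v : D}, v ∈ V ↔ φ 1 * v = v := by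
    intro v
    constructor
    · rintro ⟨d, rfl⟩
      change φ 1 * (φ 1 * d) = φ 1 * d
      rw [← mul_assoc, heφ]
    · intro hv
      exact ⟨v, hv⟩
  have hstabV : ∀ (r : R₀), ∀ v ∈ V, (Algebra.lmul ℚ D (φ r) : D →ₗ[ℚ] D) v ∈ V := by
    intro r v _
    rw [hmemV]
    change φ 1 * (φ r * v) = φ r * v
    rw [← mul_assoc, heφ]
  -- `R₀` acts on `V` through `φ` (a UNITAL action: `φ 1` is the identity of `V`)
  let ψ : R₀ →+* Module.End ℚ V :=
    { toFun := fun r => (Algebra.lmul ℚ D (φ r) : D →ₗ[ℚ] D).restrict (hstabV r)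
      map_one' := by
        refine LinearMap.ext fun v => Subtype.ext ?_
        change φ 1 * (v : D) = v
        exact hmemV.1 v.2
      map_mul' := fun a b => by
        refine LinearMap.ext fun v => Subtype.ext ?_
        change φ (a * b) * (v : D) = φ a * (φ b * v)
        rw [hmul, mul_assoc]
      map_zero' := by
        refine LinearMap.ext fun v => Subtype.ext ?_
        change φ 0 * (v : D) = 0
        rw [map_zero, zero_mul]
      map_add' := fun a b => by
        refine LinearMap.ext fun v => Subtype.ext ?_
        change φ (a + b) * (v : D) = φ a * v + φ b * v
        rw [map_add, add_mul] }
  letI : Module R₀ V := Module.compHom V ψ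
  have hsmul : ∀ (r : R₀) (v : V), ((r • v : V) : D) = φ r * v := fun _ _ => rfl
  haveI : IsScalarTower ℚ R₀ V := ⟨fun q r v => Subtype.ext (by
    change φ (q • r) * (v : D) = q • (φ r * v)
    rw [map_smul, smul_mul_assoc])⟩
  haveI : Module.Finite R₀ V := Module.Finite.of_restrictScalars_finite ℚ R₀ V
  -- `n = dim_{R₀} V > 0` (`e ∈ V`, `e ≠ 0`)
  have he0 : φ 1 ≠ 0 := fun h => one_ne_zero (hφ (by rw [h, map_zero]))
  have heV : φ 1 ∈ V := hmemV.2 (heφ 1)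
  refine ⟨finrank R₀ V, ?_, fun y => ?_⟩
  · exact finrank_pos_iff_exists_ne_zero.2 ⟨⟨φ 1, heV⟩, fun h => he0 (congrArg Subtype.val h)⟩
  -- Step 1: the trace on `D` is the trace on `V` of `y • ·`
  let q : D →ₗ[ℚ] V := (Algebra.lmul ℚ D (φ 1) : D →ₗ[ℚ] D).rangeRestrict
  let g : V →ₗ[ℚ] V := ψ y
  have hfac : (Algebra.lmul ℚ D (φ y) : D →ₗ[ℚ] D) = V.subtype ∘ₗ (g ∘ₗ q) := by
    refine LinearMap.ext fun d => ?_
    change φ y * d = φ y * (φ 1 * d)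
    rw [← mul_assoc, hφe]
  have hqi : q ∘ₗ V.subtype = LinearMap.id := by
    refine LinearMap.ext fun v => Subtype.ext ?_
    change φ 1 * (v : D) = v
    exact hmemV.1 v.2
  rw [hfac, LinearMap.trace_comp_comm', LinearMap.comp_assoc, hqi, LinearMap.comp_id]
  -- Step 2: `Tr_ℚ(y • · ∣ V) = n • Tr_{R₀/ℚ}(y)` through `V ≃ R₀^n` and the tower law
  set n := finrank R₀ V
  let b : Basis (Fin n) R₀ V := finBasis R₀ V
  let ε : V ≃ₗ[ℚ] (Fin n → R₀) := b.equivFun.restrictScalars ℚ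
  have hconj : ε.conj g = (Algebra.lmul ℚ (Fin n → R₀) (algebraMap R₀ (Fin n → R₀) y) :
      (Fin n → R₀) →ₗ[ℚ] (Fin n → R₀)) := by
    refine LinearMap.ext fun w => ?_
    rw [LinearEquiv.conj_apply, LinearMap.comp_apply, LinearMap.comp_apply]
    change ε (y • ε.symm w) = algebraMap R₀ (Fin n → R₀) y * w
    have h1 : ε (y • ε.symm w) = y • ε (ε.symm w) := b.equivFun.map_smul y (ε.symm w)
    rw [h1, LinearEquiv.apply_symm_apply, Algebra.algebraMap_eq_smul_one, smul_mul_assoc, one_mul]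
  rw [← LinearMap.trace_conj' g ε, hconj, ← Algebra.trace_apply, ← Algebra.trace_trace (S := R₀),
    Algebra.trace_algebraMap, finrank_fin_fun, map_nsmul]

/-! ## §2 A positive anti-involution stabilising the corner field -/

/-- **A positive anti-endomorphism stabilising a corner field induces a trace-positive ring endomorphism of it**:
`τ : D → Dᵐᵒᵖ` a ring anti-endomorphism with `0 < Tr_ℚ(L_{x·τx})` for `x ≠ 0`, `φ : R₀ → D` injective,
multiplicative, `ℚ`-linear with `τ(φ R₀) ⊆ φ R₀`; then `ρ := φ⁻¹ ∘ τ ∘ φ` is a ring endomorphism of the field `R₀`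
with `0 < Tr_{R₀/ℚ}(r·ρ r)` for `r ≠ 0` («Hence we have `Tr_{K/Q}(ξξ') > 0` for every `ξ ≠ 0` in `K`»).
[cite: Shimura1998, §5.1 Proposition 5 (p. 38)] [cite: MumfordAV1970, §21 proof of Thm. 2 (p. 201)] -/
theorem exists_ringHom_trace_mul_pos_of_antiHom (τ : D →+* Dᵐᵒᵖ)
    (hpos : ∀ x : D, x ≠ 0 → 0 < LinearMap.trace ℚ D (Algebra.lmul ℚ D (x * (τ x).unop)))
    (φ : R₀ →ₗ[ℚ] D) (hmul : ∀ a b : R₀, φ (a * b) = φ a * φ b) (hφ : Function.Injective φ)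
    (hstab : ∀ r : R₀, ∃ r' : R₀, (τ (φ r)).unop = φ r') :
    ∃ ρ : R₀ →+* R₀, (∀ r : R₀, φ (ρ r) = (τ (φ r)).unop) ∧
      (∀ r : R₀, r ≠ 0 → 0 < Algebra.trace ℚ R₀ (r * ρ r)) ∧
      ∀ r : R₀, 0 ≤ Algebra.trace ℚ R₀ (r * ρ r) := by
  classical
  choose ρ₀ hρ₀ using hstab
  -- `τ (φ 1) = φ 1`: `ρ₀ 1` is a non-zero idempotent of the field `R₀`
  have he0 : φ 1 ≠ 0 := fun h => one_ne_zero (hφ (by rw [h, map_zero]))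
  have hidem : ρ₀ 1 * ρ₀ 1 = ρ₀ 1 := hφ (by
    rw [hmul, ← hρ₀ 1, ← MulOpposite.unop_mul, ← map_mul, ← hmul, mul_one])
  have hρ1 : ρ₀ 1 = 1 := by
    have hz : ρ₀ 1 * (ρ₀ 1 - 1) = 0 := by rw [mul_sub, mul_one, hidem, sub_self]
    rcases mul_eq_zero.1 hz with h0 | h1
    · exfalso
      have ht : (τ (φ 1)).unop = 0 := by rw [hρ₀ 1, h0, map_zero]
      have := hpos (φ 1) he0
      rw [ht, mul_zero, map_zero, map_zero] at this
      exact lt_irrefl _ this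
    · exact sub_eq_zero.1 h1
  let ρ : R₀ →+* R₀ :=
    { toFun := ρ₀
      map_one' := hρ1
      map_mul' := fun a b => hφ (by
        rw [← hρ₀, hmul, map_mul, MulOpposite.unop_mul, hρ₀, hρ₀, ← hmul, mul_comm])
      map_zero' := hφ (by rw [← hρ₀, map_zero, map_zero, MulOpposite.unop_zero])
      map_add' := fun a b => hφ (by rw [← hρ₀, map_add, map_add, MulOpposite.unop_add, hρ₀, hρ₀, map_add]) }
  have hρ : ∀ r, φ (ρ r) = (τ (φ r)).unop := fun r => (hρ₀ r).symm
  obtain ⟨n, hn, htr⟩ := exists_trace_lmul_eq_nsmul_trace φ hmul hφ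
  have hpos' : ∀ r : R₀, r ≠ 0 → 0 < Algebra.trace ℚ R₀ (r * ρ r) := by
    intro r hr
    have hx : φ r ≠ 0 := fun h => hr (hφ (by rw [h, map_zero]))
    have h := hpos (φ r) hx
    rw [← hρ, ← hmul, htr] at h
    rw [nsmul_eq_mul] at h
    exact (mul_pos_iff_of_pos_left (by exact_mod_cast hn)).1 h
  refine ⟨ρ, hρ, hpos', fun r => ?_⟩
  rcases eq_or_ne r 0 with rfl | hr
  · rw [zero_mul, map_zero]
  · exact (hpos' r hr).le

end Literature.RingTheory.Idempotents

end
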